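import Mathlib
import HarnessLib

/-!
# `RationalShortRootRigidity` — Step 1 helper (m13): closed-set root continuity over `ℂ`

Helper lemma INSIDE the paper proof of crux `stmt-QuantumFields-23124` (`F4SubCurvatureDoor.RationalShortRootRigidity`,
LINE g15-A of planner ym-idea-3; Step 1 = `stub_reduce` (Wick-hyperbolicity of all fibres from the generic ones); free-hands
menu IV, item (m13), statement typed in HOME l15/Helpers23124c.lean as `Helpers.RootsInClosedSetLimit` — proved here DEF-FREE
with that body verbatim; the complex / closed-set form of (m5) `realRootedLimit`, p664233):

**Lemma** (`rootsInClosedSetLimit`).  Let `S ⊆ ℂ` be closed, `pₙ, q ∈ ℂ[X]` of degree exactly `k`, `q ≠ 0`, `pₙ → q`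
coefficientwise, and all roots of every `pₙ` in `S`.  Then all roots of `q` lie in `S`.

Proof (induction on `k`, one root at a time, as for (m5)).  `k = 0`: `q` is a non-zero constant.  `k + 1`: leading coefficients
converge to `a ≠ 0`, so `‖lc(pₙ)‖ ≥ ‖a‖/2` from some index on; with uniformly bounded coefficients the Cauchy-type bound
`norm_root_le` confines a chosen root `tₙ ∈ S` of `pₙ` to a closed ball; Bolzano–Weierstrass gives `t_{φ n} → t₀ ∈ S` (closedness);
the quotients `p_{φ n} /ₘ (X − t_{φ n})` (degree `k`, roots in `S`) converge coefficientwise to `q /ₘ (X − t₀)`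
(`Polynomial.coeff_divByMonic_X_sub_C`), `q(t₀) = lim p_{φ n}(t_{φ n}) = 0`, so `q = (X − t₀)·(q /ₘ (X − t₀))` and a root of `q`
is `t₀` or a root of the quotient — in `S` by induction.

Mathlib only; THEOREMS ONLY (no definitions); no named facts; no `sorry`; default heartbeats.  Nothing about the crux 23124, the
route's rung or the Yang–Mills mass gap is proved here.  Free-hands seat `ym-line-frs-p2` g10, `--supports stmt-QuantumFields-23124`.
-/

set_option autoImplicit false

namespace Summit.QuantumFields.YangMills.Theorems.RationalShortRootRigidity

open Filter Topology Finset Polynomial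
open scoped BigOperators Polynomial

/-! ## 1. A Cauchy-type root bound and uniform coefficient bounds (normed version) -/

/-- Root bound over `ℂ`: if `‖coeff i‖ ≤ B` for `i < m = natDegree p` and `0 < c ≤ ‖coeff m‖`, every root `t` of `p` has
`‖t‖ ≤ max 1 (m·B/c)`. [folklore] -/
theorem norm_root_le (p : ℂ[X]) (m : ℕ) (B c : ℝ) (t : ℂ) (hm : p.natDegree = m)
    (hB : ∀ i, i < m → ‖p.coeff i‖ ≤ B) (hc : 0 < c) (hcm : c ≤ ‖p.coeff m‖) (ht : p.IsRoot t) :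
    ‖t‖ ≤ max 1 (m * B / c) := by
  have hsum : p.eval t = ∑ i ∈ range (m + 1), p.coeff i * t ^ i := eval_eq_sum_range' (by omega) t
  rw [ht.eq_zero, sum_range_succ] at hsum
  rcases Nat.eq_zero_or_pos m with hm0 | hmpos
  · exfalso
    subst hm0
    simp only [range_zero, sum_empty, pow_zero, mul_one, zero_add] at hsum
    rw [← hsum, norm_zero] at hcm
    exact absurd hcm (not_le.2 hc)
  by_cases h1 : ‖t‖ ≤ 1
  · exact h1.trans (le_max_left _ _)
  rw [not_le] at h1
  refine le_max_of_le_right ?_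
  rw [le_div_iff₀ hc]
  set s := ‖t‖ with hs_def
  have hs1 : 1 ≤ s := h1.le
  have hspos : 0 < s := one_pos.trans h1
  have hkey : ‖p.coeff m‖ * s ^ m ≤ (m : ℝ) * (B * s ^ (m - 1)) := by
    have h2 : p.coeff m * t ^ m = -∑ i ∈ range m, p.coeff i * t ^ i := by
      rw [← sub_eq_zero, sub_neg_eq_add, add_comm]; exact hsum.symm
    calc ‖p.coeff m‖ * s ^ m = ‖p.coeff m * t ^ m‖ := by rw [norm_mul, norm_pow]
      _ = ‖∑ i ∈ range m, p.coeff i * t ^ i‖ := by rw [h2, norm_neg]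
      _ ≤ ∑ i ∈ range m, ‖p.coeff i * t ^ i‖ := norm_sum_le _ _
      _ ≤ ∑ i ∈ range m, B * s ^ (m - 1) := sum_le_sum fun i hi => ?_
      _ = (m : ℝ) * (B * s ^ (m - 1)) := by rw [sum_const, card_range, nsmul_eq_mul]
    rw [norm_mul, norm_pow]
    have him : i < m := mem_range.1 hi
    exact mul_le_mul (hB i him) (pow_le_pow_right₀ hs1 (by omega)) (pow_nonneg hspos.le _)
      ((norm_nonneg _).trans (hB i him))
  have hsm : s ^ m = s * s ^ (m - 1) := by
    rw [← pow_succ', Nat.sub_add_cancel hmpos]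
  have h3 : (c * s) * s ^ (m - 1) ≤ ((m : ℝ) * B) * s ^ (m - 1) := by
    calc (c * s) * s ^ (m - 1) = c * s ^ m := by rw [hsm]; ring
      _ ≤ ‖p.coeff m‖ * s ^ m := mul_le_mul_of_nonneg_right hcm (pow_nonneg hspos.le _)
      _ ≤ (m : ℝ) * (B * s ^ (m - 1)) := hkey
      _ = ((m : ℝ) * B) * s ^ (m - 1) := by ring
  have h4 : c * s ≤ (m : ℝ) * B := le_of_mul_le_mul_right h3 (pow_pos hspos _)
  rw [mul_comm]
  exact h4

/-- Coefficientwise convergent sequences of complex polynomials have uniformly norm-bounded coefficients below any index.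
[folklore] -/
theorem exists_coeff_norm_bound (p : ℕ → ℂ[X]) (q : ℂ[X]) (m : ℕ)
    (hcoef : ∀ i : ℕ, Tendsto (fun n => (p n).coeff i) atTop (𝓝 (q.coeff i))) :
    ∃ B : ℝ, ∀ n i, i < m → ‖(p n).coeff i‖ ≤ B := by
  have hb : ∀ i, ∃ R : ℝ, ∀ n, ‖(p n).coeff i‖ ≤ R := by
    intro i
    obtain ⟨R, hR⟩ := (Metric.isBounded_range_of_tendsto _ (hcoef i)).subset_closedBall (0 : ℂ)
    refine ⟨R, fun n => ?_⟩
    have := hR ⟨n, rfl⟩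
    rwa [Metric.mem_closedBall, dist_zero_right] at this
  choose R hR using hb
  refine ⟨∑ j ∈ range m, |R j|, fun n i hi => (hR i n).trans ((le_abs_self _).trans ?_)⟩
  exact single_le_sum (f := fun j => |R j|) (fun j _ => abs_nonneg (R j)) (mem_range.2 hi)

/-! ## 2. Closed-set root continuity -/

/-- **Closed-set root continuity over `ℂ`** (m13; Step 1 of the paper proof of 23124): the roots of a coefficientwise limit of
degree-`k` complex polynomials whose roots lie in a closed set `S` lie in `S`.  The statement is the body of
`Helpers.RootsInClosedSetLimit` (HOME l15/Helpers23124c.lean) verbatim. [folklore] -/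
theorem rootsInClosedSetLimit :
    ∀ (S : Set ℂ), IsClosed S → ∀ (k : ℕ) (p : ℕ → Polynomial ℂ) (q : Polynomial ℂ),
      (∀ n, (p n).natDegree = k) → q.natDegree = k → q ≠ 0 →
      (∀ i : ℕ, Tendsto (fun n => (p n).coeff i) atTop (nhds (q.coeff i))) →
      (∀ n, ∀ z : ℂ, (p n).IsRoot z → z ∈ S) →
      ∀ z : ℂ, q.IsRoot z → z ∈ S := by
  intro S hS k
  induction k with
  | zero =>
    intro p q _ hq hq0 _ _ z hz
    exfalso
    rw [eq_C_of_natDegree_eq_zero hq, IsRoot.def, eval_C] at hz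
    apply hq0
    rw [eq_C_of_natDegree_eq_zero hq, hz, map_zero]
  | succ k IH =>
    intro p q hdeg hq hq0 hcoef hroots
    -- the limit leading coefficient `a ≠ 0`
    set a : ℂ := q.coeff (k + 1) with ha
    have ha0 : a ≠ 0 := by
      rw [ha, ← hq, coeff_natDegree]; exact leadingCoeff_ne_zero.2 hq0
    have hp0 : ∀ n, p n ≠ 0 := fun n => ne_zero_of_natDegree_gt (n := 0) (by rw [hdeg n]; omega)
    obtain ⟨N, hN⟩ : ∃ N, ∀ n, N ≤ n → ‖a‖ / 2 ≤ ‖(p n).coeff (k + 1)‖ := by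
      have hε : (0 : ℝ) < ‖a‖ / 2 := half_pos (norm_pos_iff.2 ha0)
      obtain ⟨N, hN⟩ := Metric.tendsto_atTop.1 (hcoef (k + 1)) (‖a‖ / 2) hε
      refine ⟨N, fun n hn => ?_⟩
      have h1 := hN n hn
      rw [dist_eq_norm] at h1
      have h2 := norm_sub_norm_le a ((p n).coeff (k + 1))
      rw [← norm_neg, neg_sub] at h1
      linarith
    -- a root `t n ∈ S` of every `p n`; the roots `t (n + N)` are uniformly bounded
    have hroot : ∀ n, ∃ t : ℂ, (p n).IsRoot t := fun n =>
      Complex.exists_root (natDegree_pos_iff_degree_pos.1 (by rw [hdeg n]; exact Nat.succ_pos k))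
    choose t ht using hroot
    obtain ⟨B, hB⟩ := exists_coeff_norm_bound p q (k + 1) hcoef
    set R : ℝ := max 1 (((k + 1 : ℕ) : ℝ) * B / (‖a‖ / 2)) with hR
    have htR : ∀ n, t (n + N) ∈ Metric.closedBall (0 : ℂ) R := by
      intro n
      rw [Metric.mem_closedBall, dist_zero_right]
      exact norm_root_le (p (n + N)) (k + 1) B (‖a‖ / 2) (t (n + N)) (hdeg _) (fun i hi => hB _ i hi)
        (half_pos (norm_pos_iff.2 ha0)) (hN _ (Nat.le_add_left N n)) (ht _)
    obtain ⟨t₀, -, ψ, hψ, hlim⟩ := tendsto_subseq_of_bounded (Metric.isBounded_closedBall) htR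
    set φ : ℕ → ℕ := fun n => ψ n + N with hφ
    have hφmono : StrictMono φ := fun m n hmn => Nat.add_lt_add_right (hψ hmn) N
    have hφtop : Tendsto φ atTop atTop := hφmono.tendsto_atTop
    have hlim' : Tendsto (fun n => t (φ n)) atTop (𝓝 t₀) := hlim
    have ht₀S : t₀ ∈ S := hS.mem_of_tendsto hlim' (Eventually.of_forall fun n => hroots _ _ (ht _))
    -- the quotients by the chosen roots
    set Q : ℕ → ℂ[X] := fun n => p (φ n) /ₘ (X - C (t (φ n))) with hQ
    set q₁ : ℂ[X] := q /ₘ (X - C t₀) with hq₁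
    have hQfac : ∀ n, (X - C (t (φ n))) * Q n = p (φ n) := fun n => mul_divByMonic_eq_iff_isRoot.2 (ht _)
    have hQdeg : ∀ n, (Q n).natDegree = k := by
      intro n
      show (p (φ n) /ₘ (X - C (t (φ n)))).natDegree = k
      rw [natDegree_divByMonic _ (monic_X_sub_C _), hdeg, natDegree_X_sub_C]
      omega
    have hq₁deg : q₁.natDegree = k := by
      rw [hq₁, natDegree_divByMonic _ (monic_X_sub_C _), hq, natDegree_X_sub_C]
      omega
    have hQcoef : ∀ i : ℕ, Tendsto (fun n => (Q n).coeff i) atTop (𝓝 (q₁.coeff i)) := by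
      intro i
      have hform : ∀ n, (Q n).coeff i =
          ∑ j ∈ Icc (i + 1) (k + 1), t (φ n) ^ (j - (i + 1)) * (p (φ n)).coeff j := by
        intro n
        show (p (φ n) /ₘ (X - C (t (φ n)))).coeff i = _
        rw [coeff_divByMonic_X_sub_C, hdeg]
      have hform₁ : q₁.coeff i = ∑ j ∈ Icc (i + 1) (k + 1), t₀ ^ (j - (i + 1)) * q.coeff j := by
        rw [hq₁, coeff_divByMonic_X_sub_C, hq]
      simp_rw [hform]
      rw [hform₁]
      exact tendsto_finsetSum _ fun j _ => (hlim'.pow _).mul ((hcoef j).comp hφtop)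
    have hQroots : ∀ n, ∀ z : ℂ, (Q n).IsRoot z → z ∈ S := by
      intro n z hz
      apply hroots (φ n)
      rw [← hQfac n, IsRoot.def, eval_mul, hz.eq_zero, mul_zero]
    -- `t₀` is a root of `q`
    have hqt₀ : q.IsRoot t₀ := by
      have h1 : Tendsto (fun n => (p (φ n)).eval (t (φ n))) atTop (𝓝 (q.eval t₀)) := by
        have hform : ∀ n, (p (φ n)).eval (t (φ n)) =
            ∑ i ∈ range (k + 2), (p (φ n)).coeff i * t (φ n) ^ i :=
          fun n => eval_eq_sum_range' (by rw [hdeg]; omega) _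
        rw [eval_eq_sum_range' (show q.natDegree < k + 2 by omega)]
        simp_rw [hform]
        exact tendsto_finsetSum _ fun i _ => ((hcoef i).comp hφtop).mul (hlim'.pow _)
      have h2 : (fun n => (p (φ n)).eval (t (φ n))) = fun _ => (0 : ℂ) := funext fun n => (ht (φ n)).eq_zero
      rw [h2] at h1
      exact IsRoot.def.2 (tendsto_nhds_unique tendsto_const_nhds h1).symm
    have hfac : (X - C t₀) * q₁ = q := mul_divByMonic_eq_iff_isRoot.2 hqt₀
    have hq₁0 : q₁ ≠ 0 := by rintro h; rw [h, mul_zero] at hfac; exact hq0 hfac.symm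
    have hq₁roots : ∀ z : ℂ, q₁.IsRoot z → z ∈ S := IH Q q₁ hQdeg hq₁deg hq₁0 hQcoef hQroots
    -- conclude
    intro z hz
    rw [← hfac, IsRoot.def, eval_mul, eval_sub, eval_X, eval_C] at hz
    rcases mul_eq_zero.1 hz with h | h
    · rw [sub_eq_zero.1 h]; exact ht₀S
    · exact hq₁roots z h

end Summit.QuantumFields.YangMills.Theorems.RationalShortRootRigidity
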